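import Summits.Ventures.PercRepro.ProfilePointedCircuitClassesTwelveSeriesD
import Summits.Ventures.PercRepro.ProfilePointedCircuitClassesFourteenQuad2

/-!
# PercRepro — THE q = 7 ROW AT `n = 14` ON EVERY MATROID WITH FOUR PAIRWISE-SERIES POINTS (p5, gen 44;
`proofs/P5-GM1.md` §66 ADDENDUM 2)

The minor-quantified chain of ProfilePointedCircuitClassesSixGirth needs the twelve-point statement on every minor
`N ／ x ∖ w` of a `14`-point matroid of rank `8`.  If `N` has four pairwise-series points `S` (a series class of size
`≥ 4`; in the dual a parallel class of size `≥ 4`), then in every such minor either one of the surviving points of `S` is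
a COLOOP (`inCount_five_le_outCount_six_of_twelve_of_coloop`: the lane's coloop lemmas — deletion to the rank-`6` row
where the two sides agree), or at least three of them survive as a series class of the minor
(`x ∈ S` and `w ∈ S` together force a coloop; `ρ(E − w − s − s') = 7` from `ρ(E − s − s') = 7` and the non-coloops), and
then `inCount_five_le_outCount_six_of_seriesTriple_all` decides the statement at every point.  Hence
`InOutMinors N` (`inOutMinors_of_seriesFour`), the per-pair inequality on the minors is §64's theorem
(`inOutPairMinors_of_fourteen`), and the chain closes:
**`thresholdIneq_seven_top_of_fourteen_of_seriesFour : ThresholdIneq N 7 7`** and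
`biIndep_step_six_of_fourteen_of_seriesFour : 8·P_6 ≤ 7·P_7` — the third instance family of the first non-trivial row
`(14, 8)` of q = 7 after the girth, `Quad2Del` and sparse regimes, and the first one defined by a cocircuit structure.
-/

open scoped Matroid

namespace PercRepro.Cogirth

open Finset ThmH Skew Shadow Profile

variable {α : Type} [DecidableEq α] {N : Matroid α} [N.Finite]

section FourteenSeries

/-- **THE TWELVE-POINT STATEMENT WHEN `N` HAS A COLOOP**: on `#E = ρ(E) + 5` with `ρ(E) = 7`, a coloop `c` gives
`in_5(e) ≤ out_6(e)` at every point `e` — `e = c` by `inCount_five_le_outCount_six_of_coloop`, otherwise by deletion of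
`c` to the rank-`6` row (`in_5 ≤ in_5^{N∖c} = out_6^{N∖c} ≤ out_6`). -/
theorem inCount_five_le_outCount_six_of_twelve_of_coloop (hn : (gr N).card = rk N (gr N) + 5)
    (hR : rk N (gr N) = 7) {c : α} (hcg : c ∈ gr N) (hco : rk N ((gr N).erase c) < rk N (gr N)) {e : α}
    (he : e ∈ gr N) : inCount N 5 e ≤ outCount N 6 e := by
  by_cases hec : e = c
  · rw [hec]
    exact inCount_five_le_outCount_six_of_coloop hn hco
  have h1 := inCount_bottom_le_inCount_delete_of_coloop (ν := 5) (e := e) hn hco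
  have h2 := outCount_delete_le_outCount_of_coloop' 6 (e := e) hcg hco
  have hrk : rk N ((gr N).erase c) + 1 = rk N (gr N) := by
    have := rk_le_rk_erase_add_one (M := N) (Subset.refl (gr N)) hcg
    omega
  have hn' : (gr (N ＼ ({c} : Set α))).card =
      rk (N ＼ ({c} : Set α)) (gr (N ＼ ({c} : Set α))) + 5 := by
    rw [gr_delete', card_erase_of_mem hcg, rk_delete (Subset.refl _)]
    omega
  have he' : e ∈ gr (N ＼ ({c} : Set α)) := by
    rw [gr_delete']
    exact mem_erase.2 ⟨hec, he⟩
  have h3 := inCount_five_eq_outCount_six_of_rk_eq_six (N := N ＼ ({c} : Set α)) hn'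
    (by rw [gr_delete', rk_delete (Subset.refl _)]; omega) he'
  omega

/-- `(E − x − w − s) + x = E − w − s` for `x ∉ {w, s}`. -/
theorem insert_erase_three_eq {x w s : α} (hxg : x ∈ gr N) (hxw : x ≠ w) (hxs : x ≠ s) :
    insert x ((((gr N).erase x).erase w).erase s) = ((gr N).erase w).erase s := by
  rw [← erase_insert_of_ne hxs, insert_erase_erase_eq_erase hxg hxw]

/-- `(E − x − w − s − s') + x = E − w − s − s'` for `x ∉ {w, s, s'}`. -/
theorem insert_erase_four_eq {x w s s' : α} (hxg : x ∈ gr N) (hxw : x ≠ w) (hxs : x ≠ s) (hxs' : x ≠ s') :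
    insert x (((((gr N).erase x).erase w).erase s).erase s') = (((gr N).erase w).erase s).erase s' := by
  rw [← erase_insert_of_ne hxs', insert_erase_three_eq hxg hxw hxs]

/-- **THE MINORS' PER-POINT INEQUALITY ON `14` POINTS OF RANK `8` WITH FOUR PAIRWISE-SERIES POINTS**: in the minor
`N ／ x ∖ w` either a surviving point of `S` is a coloop, or three surviving points form a series class of the minor. -/
theorem inOutMinors_of_seriesFour (hn : (gr N).card = 14) (hR : rk N (gr N) = 8) {S : Finset α}
    (hS : S ⊆ gr N) (hS4 : S.card = 4) (hser : ∀ s ∈ S, ∀ s' ∈ S, s ≠ s' → SeriesPair N s s') :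
    InOutMinors N := by
  intro x w e hxg hwg hxw hx1 he hn₀ hR₀
  have hgr : gr ((N ／ ({x} : Set α)) ＼ ({w} : Set α)) = ((gr N).erase x).erase w := by
    rw [gr_delete', gr_contract']
  have hcard : (gr ((N ／ ({x} : Set α)) ＼ ({w} : Set α))).card = 12 := by
    rw [hgr, card_erase_of_mem (mem_erase.2 ⟨hxw.symm, hwg⟩), card_erase_of_mem hxg, hn]
  have hrk₀ : rk ((N ／ ({x} : Set α)) ＼ ({w} : Set α)) (gr ((N ／ ({x} : Set α)) ＼ ({w} : Set α))) = 7 := by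
    omega
  -- the surviving points of `S`
  have hS' : (S.erase x).erase w ⊆ gr ((N ／ ({x} : Set α)) ＼ ({w} : Set α)) := by
    rw [hgr]
    exact erase_subset_erase w (erase_subset_erase x hS)
  -- the rank of a surviving point's deletion in the minor, read in `N`
  have hdel : ∀ s ∈ (S.erase x).erase w,
      rk ((N ／ ({x} : Set α)) ＼ ({w} : Set α)) ((gr ((N ／ ({x} : Set α)) ＼ ({w} : Set α))).erase s) + 1 =
        rk N (((gr N).erase w).erase s) := by
    intro s hs
    have hsx : x ≠ s := fun h' => (mem_erase.1 (mem_of_mem_erase hs)).1 h'.symm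
    rw [rk_minor_add_one hx1 (erase_subset _ _), hgr, insert_erase_three_eq hxg hxw hsx]
  by_cases hcol : ∃ s ∈ (S.erase x).erase w,
      rk ((N ／ ({x} : Set α)) ＼ ({w} : Set α)) ((gr ((N ／ ({x} : Set α)) ＼ ({w} : Set α))).erase s) <
        rk ((N ／ ({x} : Set α)) ＼ ({w} : Set α)) (gr ((N ／ ({x} : Set α)) ＼ ({w} : Set α)))
  · obtain ⟨s, hs, hco⟩ := hcol
    exact inCount_five_le_outCount_six_of_twelve_of_coloop hn₀ hrk₀ (hS' hs) hco he
  have hcol' : ∀ s ∈ (S.erase x).erase w,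
      ¬ rk ((N ／ ({x} : Set α)) ＼ ({w} : Set α)) ((gr ((N ／ ({x} : Set α)) ＼ ({w} : Set α))).erase s) <
        rk ((N ／ ({x} : Set α)) ＼ ({w} : Set α)) (gr ((N ／ ({x} : Set α)) ＼ ({w} : Set α))) :=
    fun s hs h' => hcol ⟨s, hs, h'⟩
  -- no surviving point is a coloop of the minor: they stay pairwise in series
  have hnc : ∀ s ∈ (S.erase x).erase w,
      rk ((N ／ ({x} : Set α)) ＼ ({w} : Set α)) ((gr ((N ／ ({x} : Set α)) ＼ ({w} : Set α))).erase s) =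
        rk ((N ／ ({x} : Set α)) ＼ ({w} : Set α)) (gr ((N ／ ({x} : Set α)) ＼ ({w} : Set α))) := by
    intro s hs
    have h1 := hcol' s hs
    have h2 := rk_mono' (M := (N ／ ({x} : Set α)) ＼ ({w} : Set α))
      (erase_subset s (gr ((N ／ ({x} : Set α)) ＼ ({w} : Set α))))
    omega
  have hpair : ∀ s ∈ (S.erase x).erase w, ∀ s' ∈ (S.erase x).erase w, s ≠ s' →
      SeriesPair ((N ／ ({x} : Set α)) ＼ ({w} : Set α)) s s' := by
    intro s hs s' hs' hss'
    have hsS : s ∈ S := mem_of_mem_erase (mem_of_mem_erase hs)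
    have hs'S : s' ∈ S := mem_of_mem_erase (mem_of_mem_erase hs')
    have hsx : x ≠ s := fun h' => (mem_erase.1 (mem_of_mem_erase hs)).1 h'.symm
    have hs'x : x ≠ s' := fun h' => (mem_erase.1 (mem_of_mem_erase hs')).1 h'.symm
    have hN := hser s hsS s' hs'S hss'
    have hs'w : s' ≠ w := (mem_erase.1 hs').1
    refine ⟨hS' hs, hS' hs', hss', hnc s hs, hnc s' hs', ?_⟩
    have hgr2 : ((gr ((N ／ ({x} : Set α)) ＼ ({w} : Set α))).erase s).erase s' =
        ((((gr N).erase x).erase w).erase s).erase s' := by rw [hgr]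
    rw [rk_minor_add_one hx1 ((erase_subset _ _).trans (erase_subset _ _)), hgr2,
      insert_erase_four_eq hxg hxw hsx hs'x]
    -- `ρ(E − w − s − s') = 7`: at most `ρ(E − s − s') = 7`, at least `ρ(E − w − s) − 1 = 7`
    have hup : rk N ((((gr N).erase w).erase s).erase s') ≤ rk N (((gr N).erase s).erase s') := by
      apply rk_mono'
      intro y hy
      rw [mem_erase, mem_erase, mem_erase] at hy
      exact mem_erase.2 ⟨hy.1, mem_erase.2 ⟨hy.2.1, hy.2.2.2⟩⟩
    have hser' := hN.2.2.2.2.2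
    have hlow := rk_le_rk_erase_add_one (M := N) (X := ((gr N).erase w).erase s)
      ((erase_subset _ _).trans (erase_subset _ _)) (mem_erase.2 ⟨hss'.symm, mem_erase.2 ⟨hs'w, hS hs'S⟩⟩)
    have h1 := hdel s hs
    rw [hnc s hs] at h1
    omega
  -- three surviving points
  have h3 : 3 ≤ ((S.erase x).erase w).card := by
    by_cases hxS : x ∈ S
    · -- then `w ∉ S`, else a surviving point would be a coloop
      have hwS : w ∉ S := by
        intro hwS
        have h2 : 2 ≤ ((S.erase x).erase w).card := by
          have := pred_card_le_card_erase (s := S.erase x) (a := w)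
          have := pred_card_le_card_erase (s := S) (a := x)
          omega
        obtain ⟨s, hs⟩ := card_pos.1 (by omega : 0 < ((S.erase x).erase w).card)
        have hsS : s ∈ S := mem_of_mem_erase (mem_of_mem_erase hs)
        have hsw : s ≠ w := (mem_erase.1 hs).1
        have hN := hser s hsS w hwS hsw
        have h1 := hdel s hs
        rw [hnc s hs] at h1
        have := hN.2.2.2.2.2
        rw [erase_right_comm] at this
        omega
      have e1 := card_erase_of_mem hxS
      have e2 : (S.erase x).erase w = S.erase x := erase_eq_of_notMem (fun h' => hwS (mem_of_mem_erase h'))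
      rw [e2]
      omega
    · rw [erase_eq_of_notMem hxS]
      have := pred_card_le_card_erase (s := S) (a := w)
      omega
  obtain ⟨a, a', a'', ha, ha', ha'', haa', haa'', ha'a''⟩ := two_lt_card_iff.1 (by omega : 2 < ((S.erase x).erase w).card)
  exact inCount_five_le_outCount_six_of_seriesTriple_all hcard hrk₀ (hpair a ha a' ha' haa') (hpair a' ha' a'' ha'' ha'a'')
    haa'' he

/-- **THEOREM A'S STEP AT THE LEVEL `6` ON `14` POINTS OF RANK `8` WITH FOUR PAIRWISE-SERIES POINTS**: `8·P_6 ≤ 7·P_7`. -/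
theorem biIndep_step_six_of_fourteen_of_seriesFour (hn : (gr N).card = 14) (hR : rk N (gr N) = 8) {S : Finset α}
    (hS : S ⊆ gr N) (hS4 : S.card = 4) (hser : ∀ s ∈ S, ∀ s' ∈ S, s ≠ s' → SeriesPair N s s') :
    8 * (biIndepSets N 6).card ≤ 7 * (biIndepSets N 7).card := by
  have h := biIndep_step_six_of_nullity_six_of_minors (inOutMinors_of_seriesFour hn hR hS hS4 hser)
    (inOutPairMinors_of_fourteen hn) (by omega) (by omega)
  rw [hn] at h
  exact h

/-- **THE q = 7 ROW AT `n = 14` ON EVERY MATROID WITH FOUR PAIRWISE-SERIES POINTS**: the co-rank-7 top threshold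
`(I_7)` on every matroid with `14` points and rank `8` that has a series class of size `≥ 4` (in the dual: a parallel
class of size `≥ 4`). -/
theorem thresholdIneq_seven_top_of_fourteen_of_seriesFour (hn : (gr N).card = 14) (hR : rk N (gr N) = 8)
    {S : Finset α} (hS : S ⊆ gr N) (hS4 : S.card = 4) (hser : ∀ s ∈ S, ∀ s' ∈ S, s ≠ s' → SeriesPair N s s') :
    ThresholdIneq N 7 7 := by
  have h := thresholdIneq_seven_top_of_nullity_le_six_of_minors (inOutMinors_of_seriesFour hn hR hS hS4 hser)
    (inOutPairMinors_of_fourteen hn) (by omega) (by omega)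
  rw [hR] at h
  exact h

end FourteenSeries

end PercRepro.Cogirth
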